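import Mathlib
import Literature.Computability.Complexity.RandomKSatEnsembleOGP
import Summits.PneNP.PneNP.Theorems.OverlapGapAlgebraSearchHardWindowChainMassBasic
import Summits.PneNP.PneNP.Theorems.OverlapGapAlgebraSearchHardWindowResampleKernelBasic

/-!
# Route OverlapGapAlgebra, crux `SearchHardWindow` (stmt-PneNP-2460): the two-block Markov bound
# for the chain mass

For the `ε`-resampling Markov chain `y 0, y 1, …, y K` on a finite product space `ι → Γ`
(Huang–Sellke 2025 §3.3.2; vocabulary `resampleKernel`, `resampleChainMass` of
`Literature/Computability/Complexity/RandomKSatEnsembleOGP.lean`) the mass of an event `E` on paths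
is the finite weighted count
`resampleChainMass ε K E = (Σ_y (∏_{t<K} P_ε(y t, y (t+1))) · [E (t ↦ y (min t K))]) / #(ι → Γ)`,
the sum ranging over `y : Fin (K+1) → ι → Γ`.

`stub_chainTwoBlock` is the Markov property in the form used by the first moment of the CHAOS lemma
(Huang–Sellke 2025, Lemma 3.23) in line `Sketch`: for an event `A` that only reads the path at times
`≤ s` and a property `B` of the single instance at time `s + Δ ≤ K`,
`mass(A ∧ B@(s+Δ)) ≤ q · mass(A)` as soon as, uniformly in the starting point `w`, the length-`Δ`
segments started at `w` carry `B` at their end with total weight `≤ q`.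

The proof is path-sum surgery for an abstract nonnegative stochastic kernel `P` on a finite type `V`
(specialised at the end to `P_ε` on `ι → Γ`, nonnegative by `cmb_kernel_nonneg` and stochastic by
`stub_resampleKernelBasic` (c)). Paths are peeled at their FIRST step, `y = Fin.cons v z`
(`ctb_sum_cons`, `ctb_weight_cons`):
* `ctb_total`: `Σ_y f (y 0) · w(y) = Σ_v f v` (all steps sum out, by stochasticity);
* `ctb_truncate`: a functional reading only the first `L + 1` points may be summed over paths of
  length `L + 1` (the tail sums out) — whence the segment bound holds at every length `≥ Δ`
  (`ctb_segment_bound`);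
* `ctb_twoBlock_fin`: the bound `Σ_y w(y) F(y) G(y (s+Δ)) ≤ q Σ_y w(y) F(y)` for `F ≥ 0` reading only
  times `≤ s`, by induction on `s`: peeling the first step turns `F` into the functionals
  `z ↦ P(v, z 0) F(cons v z)` reading only times `≤ s − 1` of the shorter path, and at `s = 0` the
  functional `F(y) = f(y 0)` factors through the starting point, where the segment bound applies.
Finally `[A ∧ B] = [A] · [B]` and both sides of the claim are such path sums divided by `#(ι → Γ)`.
-/

set_option linter.dupNamespace false -- `Summit.PneNP.PneNP.…`: summit = sub-problem

namespace Summit.PneNP.PneNP.Theorems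

open Finset
open Literature.Computability.Complexity
open scoped Classical

section AbstractKernel

variable {V : Type*}

/-- The path weight of `Fin.cons v z` factors as the first step `P v (z 0)` times the weight of `z`. -/
theorem ctb_weight_cons (P : V → V → ℝ) (K : ℕ) (v : V) (z : Fin (K + 1) → V) :
    ∏ t : Fin (K + 1), P ((Fin.cons v z : Fin (K + 1 + 1) → V) t.castSucc)
        ((Fin.cons v z : Fin (K + 1 + 1) → V) t.succ) =
      P v (z 0) * ∏ t : Fin K, P (z t.castSucc) (z t.succ) := by
  rw [Fin.prod_univ_succ]
  simp only [Fin.castSucc_zero, Fin.cons_zero, Fin.cons_succ, Fin.castSucc_succ]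

/-- Restricting `Fin.cons v z` to its first `L + 2` entries is `Fin.cons v` of the restriction of `z`
to its first `L + 1` entries. -/
theorem ctb_cons_castLE {L K : ℕ} (h : L + 1 + 1 ≤ K + 1 + 1) (v : V) (z : Fin (K + 1) → V) :
    (fun i : Fin (L + 1 + 1) => (Fin.cons v z : Fin (K + 1 + 1) → V) (Fin.castLE h i)) =
      Fin.cons v (fun i : Fin (L + 1) => z (Fin.castLE (Nat.succ_le_succ_iff.mp h) i)) := by
  funext i
  refine Fin.cases ?_ (fun j => ?_) i
  · simp
  · simp

/-- The indicator of a conjunction is the product of the indicators (any `Decidable` instances,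
conjuncts up to `↔`). -/
theorem ctb_ite_and_eq {p p' r r' : Prop} {hpr : Decidable (p ∧ r)} {hp : Decidable p'}
    {hr : Decidable r'} (h1 : p ↔ p') (h2 : r ↔ r') :
    @ite ℝ (p ∧ r) hpr 1 0 = @ite ℝ p' hp 1 0 * @ite ℝ r' hr 1 0 := by
  by_cases a : p
  · by_cases b : r
    · rw [if_pos ⟨a, b⟩, if_pos (h1.1 a), if_pos (h2.1 b), mul_one]
    · rw [if_neg (fun h => b h.2), if_neg (fun h => b (h2.2 h)), mul_zero]
  · rw [if_neg (fun h => a h.1), if_neg (fun h => a (h1.2 h)), zero_mul]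

variable [Fintype V]

/-- Reindex a sum over paths of length `n + 1` by (first point, remaining path): `y = Fin.cons v z`. -/
theorem ctb_sum_cons (n : ℕ) (Φ : (Fin (n + 1) → V) → ℝ) :
    ∑ y : Fin (n + 1) → V, Φ y = ∑ v : V, ∑ z : Fin n → V, Φ (Fin.cons v z) := by
  rw [← (Fin.consEquiv fun _ : Fin (n + 1) => V).sum_comp, Fintype.sum_prod_type]
  rfl

/-- Total mass of the chain from a weighted start, for a stochastic kernel `P`:
`Σ_y f (y 0) · ∏_{t<K} P (y t) (y (t+1)) = Σ_v f v` (the `K` steps sum out one at a time). -/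
theorem ctb_total (P : V → V → ℝ) (hP1 : ∀ u, ∑ v, P u v = 1) :
    ∀ (K : ℕ) (f : V → ℝ),
      ∑ y : Fin (K + 1) → V, f (y 0) * ∏ t : Fin K, P (y t.castSucc) (y t.succ) = ∑ v, f v
  | 0, f => by
    rw [← (Equiv.funUnique (Fin 1) V).symm.sum_comp]
    simp
  | K + 1, f => by
    rw [ctb_sum_cons (K + 1)]
    simp only [Fin.cons_zero, ctb_weight_cons]
    refine Finset.sum_congr rfl fun v _ => ?_
    have ih := ctb_total P hP1 K (fun u => f v * P v u)
    rw [← Finset.mul_sum, hP1, mul_one] at ih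
    refine Eq.trans (Finset.sum_congr rfl fun z _ => ?_) ih
    ring

/-- **Truncation (marginalising the tail of the chain).** For a stochastic kernel, a path functional
that only reads the first `L + 1` points can be summed over paths of length `L + 1` instead of
`K + 1 ≥ L + 1`: the last `K − L` steps sum out to `1`. -/
theorem ctb_truncate (P : V → V → ℝ) (hP1 : ∀ u, ∑ v, P u v = 1) :
    ∀ (L K : ℕ) (h : L + 1 ≤ K + 1) (Φ : (Fin (L + 1) → V) → ℝ),
      ∑ y : Fin (K + 1) → V, (∏ t : Fin K, P (y t.castSucc) (y t.succ)) *
          Φ (fun i => y (Fin.castLE h i)) =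
        ∑ z : Fin (L + 1) → V, (∏ t : Fin L, P (z t.castSucc) (z t.succ)) * Φ z
  | 0, K, h, Φ => by
    have hΦ : ∀ x : Fin (0 + 1) → V, Φ x = Φ (fun _ => x 0) := fun x =>
      congrArg Φ (funext fun i => congrArg x
        (Fin.ext (by have hi := i.2; simp only [Fin.val_zero]; omega)))
    calc ∑ y : Fin (K + 1) → V, (∏ t : Fin K, P (y t.castSucc) (y t.succ)) *
          Φ (fun i => y (Fin.castLE h i))
        = ∑ y : Fin (K + 1) → V, Φ (fun _ => y 0) * ∏ t : Fin K, P (y t.castSucc) (y t.succ) :=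
          Finset.sum_congr rfl fun y _ => by
            rw [hΦ (fun i => y (Fin.castLE h i))]
            simp only [Fin.castLE_zero]
            rw [mul_comm]
      _ = ∑ v, Φ (fun _ => v) := ctb_total P hP1 K (fun v => Φ (fun _ => v))
      _ = ∑ z : Fin (0 + 1) → V, Φ (fun _ => z 0) * ∏ t : Fin 0, P (z t.castSucc) (z t.succ) :=
          (ctb_total P hP1 0 (fun v => Φ (fun _ => v))).symm
      _ = ∑ z : Fin (0 + 1) → V, (∏ t : Fin 0, P (z t.castSucc) (z t.succ)) * Φ z :=
          Finset.sum_congr rfl fun z _ => by rw [hΦ z, mul_comm]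
  | L + 1, K, h, Φ => by
    obtain ⟨K', rfl⟩ : ∃ K', K = K' + 1 := ⟨K - 1, by omega⟩
    have h' : L + 1 ≤ K' + 1 := by omega
    calc ∑ y : Fin (K' + 1 + 1) → V, (∏ t : Fin (K' + 1), P (y t.castSucc) (y t.succ)) *
          Φ (fun i => y (Fin.castLE h i))
        = ∑ v, ∑ z : Fin (K' + 1) → V, (∏ t : Fin K', P (z t.castSucc) (z t.succ)) *
            (P v ((fun i : Fin (L + 1) => z (Fin.castLE h' i)) 0) *
              Φ (Fin.cons v (fun i : Fin (L + 1) => z (Fin.castLE h' i)))) := by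
          rw [ctb_sum_cons (K' + 1)]
          simp only [ctb_weight_cons, ctb_cons_castLE, Fin.castLE_zero]
          exact Finset.sum_congr rfl fun v _ => Finset.sum_congr rfl fun z _ => by ring
      _ = ∑ v, ∑ x : Fin (L + 1) → V, (∏ t : Fin L, P (x t.castSucc) (x t.succ)) *
            (P v (x 0) * Φ (Fin.cons v x)) :=
          Finset.sum_congr rfl fun v _ =>
            ctb_truncate P hP1 L K' h' (fun x => P v (x 0) * Φ (Fin.cons v x))
      _ = ∑ y : Fin (L + 1 + 1) → V, (∏ t : Fin (L + 1), P (y t.castSucc) (y t.succ)) * Φ y := by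
          rw [ctb_sum_cons (L + 1)]
          simp only [ctb_weight_cons]
          exact Finset.sum_congr rfl fun v _ => Finset.sum_congr rfl fun z _ => by ring

variable [DecidableEq V]

/-- **The segment bound transfers to every length.** If every length-`Δ` segment started at `w`
carries `G` at its end with total weight `≤ q`, then on paths of any length `K ≥ Δ` started at `w`
the weight of `G` read at time `Δ` is `≤ q` (the steps after time `Δ` sum out, `ctb_truncate`). -/
theorem ctb_segment_bound (P : V → V → ℝ) (hP1 : ∀ u, ∑ v, P u v = 1) (Δ : ℕ) (G : V → ℝ)
    (q : ℝ)
    (hq : ∀ w : V, ∑ x : Fin (Δ + 1) → V,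
        (if x 0 = w then (∏ t : Fin Δ, P (x t.castSucc) (x t.succ)) * G (x (Fin.last Δ)) else 0)
          ≤ q)
    (K : ℕ) (m : Fin (K + 1)) (hm : (m : ℕ) = Δ) (w : V) :
    ∑ y : Fin (K + 1) → V,
        (if y 0 = w then (∏ t : Fin K, P (y t.castSucc) (y t.succ)) * G (y m) else 0) ≤ q := by
  have h : Δ + 1 ≤ K + 1 := by have := m.2; omega
  have key := ctb_truncate P hP1 Δ K h (fun x => if x 0 = w then G (x (Fin.last Δ)) else 0)
  have e1 : Fin.castLE h (Fin.last Δ) = m := Fin.ext (by simp [hm])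
  simp only [Fin.castLE_zero, e1, mul_ite, mul_zero] at key
  rw [key]
  exact hq w

/-- **Two-block Markov bound, `Fin`-indexed form.** For a nonnegative stochastic kernel `P`, a
nonnegative path functional `F` reading only times `≤ s`, a function `G` of the point at time
`m = s + Δ ≤ K`, and a uniform segment bound `q` for `G` (at every length, as produced by
`ctb_segment_bound`): `Σ_y w(y) F(y) G(y m) ≤ q · Σ_y w(y) F(y)`. Induction on `s`, peeling the
first step of the path. -/
theorem ctb_twoBlock_fin (P : V → V → ℝ) (hP0 : ∀ u v, 0 ≤ P u v) (hP1 : ∀ u, ∑ v, P u v = 1)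
    (Δ : ℕ) (G : V → ℝ) (q : ℝ)
    (hq : ∀ (K : ℕ) (m : Fin (K + 1)), (m : ℕ) = Δ → ∀ w : V, ∑ y : Fin (K + 1) → V,
        (if y 0 = w then (∏ t : Fin K, P (y t.castSucc) (y t.succ)) * G (y m) else 0) ≤ q) :
    ∀ (s K : ℕ) (m : Fin (K + 1)), (m : ℕ) = s + Δ → ∀ (F : (Fin (K + 1) → V) → ℝ),
      (∀ y, 0 ≤ F y) → (∀ y y', (∀ i : Fin (K + 1), (i : ℕ) ≤ s → y i = y' i) → F y = F y') →
      ∑ y : Fin (K + 1) → V, (∏ t : Fin K, P (y t.castSucc) (y t.succ)) * (F y * G (y m)) ≤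
        q * ∑ y : Fin (K + 1) → V, (∏ t : Fin K, P (y t.castSucc) (y t.succ)) * F y
  | 0, K, m, hm, F, hF0, hF => by
    -- `F` only reads the starting point `y 0`
    have hFy : ∀ y : Fin (K + 1) → V, F y = F (fun _ => y 0) := fun y =>
      hF y (fun _ => y 0) fun i hi => by
        have hi0 : i = 0 := Fin.ext (by simp only [Fin.val_zero]; omega)
        rw [hi0]
    have hsumF : ∑ y : Fin (K + 1) → V, (∏ t : Fin K, P (y t.castSucc) (y t.succ)) * F y =
        ∑ v, F (fun _ => v) := by
      calc ∑ y : Fin (K + 1) → V, (∏ t : Fin K, P (y t.castSucc) (y t.succ)) * F y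
          = ∑ y : Fin (K + 1) → V, F (fun _ => y 0) * ∏ t : Fin K, P (y t.castSucc) (y t.succ) :=
            Finset.sum_congr rfl fun y _ => by rw [hFy y, mul_comm]
        _ = ∑ v, F (fun _ => v) := ctb_total P hP1 K (fun v => F (fun _ => v))
    calc ∑ y : Fin (K + 1) → V, (∏ t : Fin K, P (y t.castSucc) (y t.succ)) * (F y * G (y m))
        = ∑ y : Fin (K + 1) → V, ∑ v, (if y 0 = v then
            F (fun _ => v) * ((∏ t : Fin K, P (y t.castSucc) (y t.succ)) * G (y m)) else 0) := by
          refine Finset.sum_congr rfl fun y _ => ?_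
          rw [Fintype.sum_ite_eq (y 0) (fun v =>
            F (fun _ => v) * ((∏ t : Fin K, P (y t.castSucc) (y t.succ)) * G (y m))), hFy y]
          ring
      _ = ∑ v, F (fun _ => v) * ∑ y : Fin (K + 1) → V, (if y 0 = v then
            (∏ t : Fin K, P (y t.castSucc) (y t.succ)) * G (y m) else 0) := by
          rw [Finset.sum_comm]
          refine Finset.sum_congr rfl fun v _ => ?_
          rw [Finset.mul_sum]
          refine Finset.sum_congr rfl fun y _ => ?_
          rw [mul_ite, mul_zero]
      _ ≤ ∑ v, F (fun _ => v) * q :=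
          Finset.sum_le_sum fun v _ => mul_le_mul_of_nonneg_left (hq K m (by omega) v) (hF0 _)
      _ = q * ∑ y : Fin (K + 1) → V, (∏ t : Fin K, P (y t.castSucc) (y t.succ)) * F y := by
          rw [hsumF, ← Finset.sum_mul, mul_comm]
  | s + 1, K, m, hm, F, hF0, hF => by
    obtain ⟨K', rfl⟩ : ∃ K', K = K' + 1 := ⟨K - 1, by have := m.2; omega⟩
    obtain ⟨m', rfl, hm'⟩ : ∃ m' : Fin (K' + 1), m = m'.succ ∧ (m' : ℕ) = s + Δ :=
      ⟨⟨s + Δ, by have := m.2; omega⟩, Fin.ext (by simp only [Fin.val_succ]; omega), rfl⟩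
    -- peel the first step, `y = Fin.cons v z`: the new functionals `z ↦ P v (z 0) · F (cons v z)`
    have hF0' : ∀ (v : V) (z : Fin (K' + 1) → V), 0 ≤ P v (z 0) * F (Fin.cons v z) :=
      fun v z => mul_nonneg (hP0 _ _) (hF0 _)
    have hF' : ∀ (v : V) (z z' : Fin (K' + 1) → V),
        (∀ i : Fin (K' + 1), (i : ℕ) ≤ s → z i = z' i) →
        P v (z 0) * F (Fin.cons v z) = P v (z' 0) * F (Fin.cons v z') := by
      intro v z z' hzz'
      rw [hzz' 0 (by simp only [Fin.val_zero]; omega)]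
      congr 1
      refine hF _ _ fun i hi => ?_
      cases i using Fin.cases with
      | zero => simp only [Fin.cons_zero]
      | succ j =>
        simp only [Fin.cons_succ]
        exact hzz' j (by simp only [Fin.val_succ] at hi; omega)
    calc ∑ y : Fin (K' + 1 + 1) → V, (∏ t : Fin (K' + 1), P (y t.castSucc) (y t.succ)) *
          (F y * G (y m'.succ))
        = ∑ v, ∑ z : Fin (K' + 1) → V, (∏ t : Fin K', P (z t.castSucc) (z t.succ)) *
            ((P v (z 0) * F (Fin.cons v z)) * G (z m')) := by
          rw [ctb_sum_cons (K' + 1)]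
          simp only [ctb_weight_cons]
          simp only [Fin.cons_succ]
          exact Finset.sum_congr rfl fun v _ => Finset.sum_congr rfl fun z _ => by ring
      _ ≤ ∑ v, q * ∑ z : Fin (K' + 1) → V, (∏ t : Fin K', P (z t.castSucc) (z t.succ)) *
            (P v (z 0) * F (Fin.cons v z)) :=
          Finset.sum_le_sum fun v _ =>
            ctb_twoBlock_fin P hP0 hP1 Δ G q hq s K' m' hm'
              (fun z => P v (z 0) * F (Fin.cons v z)) (hF0' v) (hF' v)
      _ = q * ∑ y : Fin (K' + 1 + 1) → V,
            (∏ t : Fin (K' + 1), P (y t.castSucc) (y t.succ)) * F y := by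
          rw [← Finset.mul_sum]
          congr 1
          rw [ctb_sum_cons (K' + 1)]
          simp only [ctb_weight_cons]
          exact Finset.sum_congr rfl fun v _ => Finset.sum_congr rfl fun z _ => by ring

end AbstractKernel

/-- **Two-block Markov bound for the chain mass** of the `ε`-resampling chain (`0 ≤ ε ≤ 1`;
Huang–Sellke 2025 §3.3.2, the Markov property behind the first moment of Lemma 3.23): if the event
`A` only reads the path at times `≤ s` and `B` is a property of the instance at time `s + Δ ≤ K`,
then `mass(A ∧ B(z (s+Δ))) ≤ q · mass(A)` whenever every length-`Δ` segment of the chain, started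
at any point `w`, carries `B` at its end with total weight `≤ q`. -/
theorem stub_chainTwoBlock {ι Γ : Type*} [Fintype ι] [DecidableEq ι] [Fintype Γ] [DecidableEq Γ]
    [Nonempty Γ] (ε : ℝ) (hε0 : 0 ≤ ε) (hε1 : ε ≤ 1) (K s Δ : ℕ) (hsΔ : s + Δ ≤ K)
    (A : (ℕ → ι → Γ) → Prop) (hA : ∀ z z' : ℕ → ι → Γ, (∀ t ≤ s, z t = z' t) → (A z ↔ A z'))
    (B : (ι → Γ) → Prop) (q : ℝ)
    (hq : ∀ w : ι → Γ, ∑ y : Fin (Δ + 1) → ι → Γ,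
        (if y 0 = w then (∏ t : Fin Δ, resampleKernel ε (y t.castSucc) (y t.succ)) *
          (if B (y (Fin.last Δ)) then (1 : ℝ) else 0) else 0) ≤ q) :
    resampleChainMass ε K (fun z => A z ∧ B (z (s + Δ))) ≤ q * resampleChainMass ε K A := by
  have hP0 : ∀ u v : ι → Γ, 0 ≤ resampleKernel ε u v := cmb_kernel_nonneg ε hε0 hε1
  have hP1 : ∀ u : ι → Γ, ∑ v, resampleKernel ε u v = 1 :=
    (stub_resampleKernelBasic ε hε0 hε1).2.2
  -- the segment bound at every length `≥ Δ`
  have hq' := ctb_segment_bound (resampleKernel ε) hP1 Δ (fun v => if B v then (1 : ℝ) else 0) q hq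
  -- `[A]` is nonnegative and only reads times `≤ s`
  have hF0 : ∀ y : Fin (K + 1) → ι → Γ,
      0 ≤ (if A (fun t => y ⟨min t K, Nat.lt_succ_of_le (Nat.min_le_right t K)⟩) then (1 : ℝ)
        else 0) :=
    fun y => by split_ifs <;> norm_num
  have hF : ∀ y y' : Fin (K + 1) → ι → Γ, (∀ i : Fin (K + 1), (i : ℕ) ≤ s → y i = y' i) →
      (if A (fun t => y ⟨min t K, Nat.lt_succ_of_le (Nat.min_le_right t K)⟩) then (1 : ℝ)
        else 0) =
      (if A (fun t => y' ⟨min t K, Nat.lt_succ_of_le (Nat.min_le_right t K)⟩) then (1 : ℝ)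
        else 0) :=
    fun y y' hyy' => cmb_ite_congr (hA _ _ fun t ht => hyy' _ (le_trans (Nat.min_le_left t K) ht))
  have key := ctb_twoBlock_fin (resampleKernel ε) hP0 hP1 Δ (fun v => if B v then (1 : ℝ) else 0)
    q hq' s K ⟨s + Δ, Nat.lt_succ_of_le hsΔ⟩ rfl
    (fun y => if A (fun t => y ⟨min t K, Nat.lt_succ_of_le (Nat.min_le_right t K)⟩) then (1 : ℝ)
      else 0) hF0 hF
  unfold resampleChainMass
  rw [← mul_div_assoc]
  refine div_le_div_of_nonneg_right
    ((Finset.sum_congr rfl fun y _ => ?_).trans_le key) (Nat.cast_nonneg _)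
  -- pathwise, `[A ∧ B (z (s + Δ))] = [A] · [B (y (s + Δ))]`
  have e : y ⟨min (s + Δ) K, Nat.lt_succ_of_le (Nat.min_le_right (s + Δ) K)⟩ =
      y ⟨s + Δ, Nat.lt_succ_of_le hsΔ⟩ := congrArg y (Fin.ext (min_eq_left hsΔ))
  exact congrArg _ (ctb_ite_and_eq Iff.rfl (Iff.of_eq (congrArg B e)))

end Summit.PneNP.PneNP.Theorems
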